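import Summits.ResolutionOfSingularities.ResolutionOfSingularities.Theorems.FrobeniusClosingSteerWords08SteeredKThree
import Summits.ResolutionOfSingularities.ResolutionOfSingularities.Theorems.FrobeniusClosingSteerNoEternalChainThree
import Summits.ResolutionOfSingularities.ResolutionOfSingularities.Theorems.FrobeniusClosingSteerHironakaLUIsolatedBranchOfCP
import Literature.AlgebraicGeometry.Resolution.ArithmeticalThreefoldsLocalPermissible

/-!
# Crux `Steer` (stmt-ResolutionOfSingularities-16345), line `switching-dichotomy` — WORDS 09: §σ2.14′ / §σ2.14″ / §σ2.15 / §σ2.17 of the p = 2 σ_top-STEERED COMPOSITION — the G⁺ leaf `geoDict_holds` (res-D-pv-011 p503815/p506007), the P⁺ adoption leaves (res-L0-w41-stub-3 p505119), the σ-RESIDUAL RE-CUT BY REGIME (res-L0-w41-strat-2 memo §4b: `SteeredTailHighConclTwo` / `SteeredTailLowConclTwo` …) and §σ2.17 THE T-LINE ON NAMED-FACT DEBTS (K(3) via Cossart–Piltant 2019) (HOIST of the registered skeleton r36 91a5a25981868d37, l.1055–1289, inside `section SteeredTwo`)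

Holder res-L0-w41-lead-1 g5 on res-L0-w41-plan-1 RULING 47 (E1) / 104b; see `…Words01Core` for the hoist protocol (bodies byte for byte;
`[cite: …]` / `[folklore]` tags on CLOSED `def … : Prop` words are written «(ref. …)» / «(folklore)» — GATE NOTE of `…Words02Stubs`;
cite keys inside `[cite:]` tags normalised to `references.bib` keys where needed, as in `…Words03Phases`).
Nothing here is a statement of the manuscript [claim: Hironaka2017, status: under-review]. OURS (candidates / vocabulary; AI review is
weaker than expert review).
-/

open Summit.ResolutionOfSingularities.ResolutionOfSingularities.Theses.FrobeniusClosing (IsolatedForcedTermination)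
open Literature.AlgebraicGeometry.Resolution (IsAbhyankarPlace FGOver exists_ringKrullDim_eq_and_trdeg_eq
  trdeg_eq_trdeg_of_isFractionRing locAtCentre IsQuadraticTransformAlong SubringDominates IsRsopPart
  LocalUniformization3 RelLocalUniformization CossartPiltant2019General)
open Summit.ResolutionOfSingularities.ResolutionOfSingularities.Theorems.SteerRankThinness
  (HasProperCoarsening concl_of_hasProperCoarsening rankOne_of_not_hasProperCoarsening)
open Summit.ResolutionOfSingularities.ResolutionOfSingularities.Theorems.PfaffLine

set_option linter.dupNamespace false

namespace Summit.ResolutionOfSingularities.ResolutionOfSingularities.Theorems.SwitchingDichotomy.Words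

section SteeredTwo

open IsLocalRing
open Literature.AlgebraicGeometry.Resolution (IsLocalBlowupAlong IsQuadraticTransform IsExcellentRing)

variable {K : Type} [Field K]


/-! ### §σ2.14′ (holder res-L0-w41-lead-1 g4, 2026-08-27; replaces res-L0-w41-plan-1 g7's §σ2.14 e-free leaf over p503815,
whose module `…Theorems.FrobeniusClosingSteerGeoDict` is not built on the Lean farm («remote:stale:…:unbuilt», 06:10–07:05Z), by the
G⁺ leaf over a module that is) — **G⁺ ADOPTION LEAF**: `GeoDictFin` is CLOSED BY NAME over res-D-pv-011 AS res-L0-w41-stub-7's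
UNCONDITIONAL re-assembly p506007 `GeoDict.not_noEternalChainFin_of_dominantTail` (G0/G2–G10 by name underneath; member
regularity from res-D-pv-012 AS stub-8's p501181 `SteeredMembersRegular.isRegularLocalRing_steps`; the model of `R i₀` from
`SteeredExit.exists_model_of_tower`; the residue datum G11 = res-type-096's p505235
`GeoDict.exists_derivation_commonKernel_residueField_of_locChar` over res-L0-w41-stub-3's P p504438) — pv-011's kernel-checked leaf
text VERBATIM (HOME `D/res-D-pv-011/GeoDictFinAdoptionTest.lean`, evidence «Gplus-GeoDictFin-landed.md» on stmt-16345); the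
e-free `GeoDict` follows by `geoDict_of_fin`. **K(2) CONDITIONAL LEAF** over res-type-026's p505893
`RadicandChainTwo.noEternalIsolatedRadicandChain_two`, modulo the tree's NAMED FACT `Lipman1978NoEternalNormalBranch` (Lipman 1978,
Thm. p. 151; unproved in the tree = a formalization debt, not an open problem). The T-line after r23:
`eternalSteeredRunTwo_of_residual : SteeredTailConclTwo → GeoDictFinrank → Lipman1978NoEternalNormalBranch →
(∀ p, p.Prime → NoEternalIsolatedRadicandChainFinrank p 3 1) → EternalSteeredRunTwo` — open inputs: the σ-residual (FRONTIER),
G⁺ of record `GeoDictFinrank` (DISCHARGEABLE: p506007's construction + the residue p-rank pin, res-type-096 / pv-011), K(3) at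
p-rank 1 (OPEN), one fact debt. Helper compositions; nothing registered changes. OURS. [folklore] -/

/-- **G⁺ · `GeoDictFin` holds** (adoption leaf over p506007 + G11 p505235 + M p501181; res-D-pv-011's certified text verbatim).
OURS. [folklore] -/
theorem geoDictFin_holds : GeoDictFin := by
  intro p hp n hn k K _ _ _ _ _ O A₀ h₀ t core R P s i₀ c hR0 hrun htail
  haveI := Fact.mk hp
  haveI : CharP K p := charP_of_injective_algebraMap (algebraMap k K).injective p
  obtain ⟨hfg, htp, -, hreg, -⟩ := core
  obtain ⟨-, hstep⟩ := hrun
  have hsp : ∀ i, s i ^ p ∈ R i := fun i => by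
    obtain ⟨_, hs, -⟩ := hstep i
    exact hs
  have hbl : ∀ i, IsLocalBlowupAlong O (R i) (P i) (R (i + 1)) := fun i => by
    obtain ⟨_, _, -, hbl, -⟩ := hstep i
    exact hbl
  have h0 : IsRegularLocalRing (R 0) := by
    rw [hR0]
    exact (Literature.AlgebraicGeometry.Resolution.isRegularLocalRing_locAtCentre_iff h₀).mpr hreg
  have hregR : ∀ i, IsRegularLocalRing (R i) := fun i =>
    _root_.Summit.ResolutionOfSingularities.ResolutionOfSingularities.Theorems.SwitchingDichotomy.SteeredMembersRegular.isRegularLocalRing_steps (O := O) R P i h0 (fun j _ => by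
      obtain ⟨hloc, hs, hσ, hblj, -⟩ := hstep j
      refine ⟨hloc, ?_, hblj⟩
      rcases hσ with hperm | ⟨hP, -, -⟩
      · exact Or.inl hperm.2.2.1
      · exact Or.inr hP) i le_rfl
  have hperm : ∀ i, i₀ ≤ i → IsPermissibleCentre (R i) p ⟨s i ^ p, hsp i⟩ (P i) := fun i hi => by
    obtain ⟨hloc, hs, hσ, -, -⟩ := hstep i
    obtain ⟨⟨_, hne⟩, -, -⟩ := htail i hi
    rcases hσ with hperm | ⟨hP, -, -⟩
    · exact hperm
    · exact absurd hP hne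
  -- the model of `R i₀` (for the residue datum, G11)
  obtain ⟨A₁, -, -, hfg₁, hRA₁⟩ := _root_.Summit.ResolutionOfSingularities.ResolutionOfSingularities.Theorems.SwitchingDichotomy.SteeredExit.exists_model_of_tower O A₀ h₀ hfg hR0 (N := i₀)
    fun i _ => (hbl i).isLocalBlowup
  haveI : (P i₀).IsPrime := (hperm i₀ le_rfl).2.1.1
  refine _root_.Summit.ResolutionOfSingularities.ResolutionOfSingularities.Theorems.SwitchingDichotomy.GeoDict.not_noEternalChainFin_of_dominantTail p O A₀ h₀ hfg R P s i₀ c hR0 hbl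
    (fun i => by obtain ⟨_, _, -, -, hst⟩ := hstep i; exact hst) hsp
    (fun i hi => (hperm i hi).2.1.1) (fun i hi => (hperm i hi).2.2.2) (fun i hi => (htail i hi).2.1)
    (fun i hi => (htail i hi).2.2) hregR (fun i hi Q hQp hQ => ?_)
    (fun T hTloc hTc => by
      haveI := hTloc
      exact _root_.Summit.ResolutionOfSingularities.ResolutionOfSingularities.Theorems.SwitchingDichotomy.GeoDict.exists_derivation_commonKernel_residueField_of_locChar p O A₁ hRA₁ hTc hfg₁)
  obtain ⟨_, -, hmc, -⟩ := (hperm i hi).2.1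
  by_contra hnr
  exact hQ.ne (hmc Q hnr hQ.le)

/-- **G · `GeoDict` holds** (the e-free core, from G⁺ by forgetting the residue datum). OURS. [folklore] -/
theorem geoDict_holds : GeoDict := geoDict_of_fin geoDictFin_holds

/-- **P · `FGFieldPBasisDual` holds** (adoption leaf over p504438 `PBasisDual.fgFieldPBasisDual`, res-L0-w41-stub-3; P is the
derivation-currency ingredient of `GeoDictFin` / package (I) and is banked — the T-line of record (package (II)) does not consume
it). OURS. [folklore] -/
theorem fgFieldPBasisDual_holds : FGFieldPBasisDual :=
  _root_.Summit.ResolutionOfSingularities.ResolutionOfSingularities.Theorems.SwitchingDichotomy.PBasisDual.fgFieldPBasisDual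

/-- **K(2) modulo Lipman 1978** (adoption leaf over res-type-026's p505893 `RadicandChainTwo.noEternalIsolatedRadicandChain_two`,
realised through p502783 / p503167 / p503765 / p504378 by res-type-026 and res-D-pv-015 AS o8; the hypothesis is the tree's NAMED FACT
`Literature.AlgebraicGeometry.Resolution.Lipman1978NoEternalNormalBranch` — a formalization debt). OURS. [cite: Lipman1978, Thm. p. 151] -/
theorem noEternalIsolatedRadicandChain_two_of_lipman
    (hL : Literature.AlgebraicGeometry.Resolution.Lipman1978NoEternalNormalBranch.{0}) :
    ∀ p : ℕ, p.Prime → NoEternalIsolatedRadicandChain p 2 :=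
  fun p hp => _root_.Summit.ResolutionOfSingularities.ResolutionOfSingularities.Theorems.SwitchingDichotomy.RadicandChainTwo.noEternalIsolatedRadicandChain_two hL p hp

/-- **The p = 2 T-line after r23** (pure logic): T ⇐ σ-residual `SteeredTailConclTwo` (FRONTIER) + G⁺ `GeoDictFinrank`
(DISCHARGEABLE) + Lipman 1978 (NAMED FACT, debt) + K(3) at p-rank 1 (OPEN). OURS. [folklore] -/
theorem eternalSteeredRunTwo_of_residual (hTail : SteeredTailConclTwo) (hG : GeoDictFinrank)
    (hL : Literature.AlgebraicGeometry.Resolution.Lipman1978NoEternalNormalBranch.{0})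
    (hK3 : ∀ p : ℕ, p.Prime → NoEternalIsolatedRadicandChainFinrank p 3 1) : EternalSteeredRunTwo :=
  eternalSteeredRunTwo_of_finrank2 hTail hG (noEternalIsolatedRadicandChain_two_of_lipman hL) hK3

/-! ## R2TwoSigma-r23.minidelta.lean — snippet v10′ MINI-DELTA over the REGISTERED r23 (res-L0-w41-lead-1, 08fdfe1a18d6e54c,
2920 l.) — res-L0-w41-plan-1 g7, 2026-08-27. Paste the body BEFORE `end SteeredTwo` (r23 l.2101); NO new imports (PBasisDual is
already imported by r23). Contents: §σ2.14″ the two P⁺ leaves over stub-3's p505119 (`finrankDerivationAdapter_holds`,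
`fgFieldPBasisDualAt_holds`) + the FinAt-currency T-line `eternalSteeredRunTwo_of_residual_finAt`; §σ2.15 res-L0-w41-strat-2's
REGIME RE-CUT of the σ-residual (STRAT2-MEMO-1 §4b / Sketch-sigma-orders b9c64501f7a4e672: `IsHighOrderAt`,
`HighOrderTailConclTwo`, `LowOrderTailConclTwo`, glue `steeredTailConclTwo_of_orders`, T-line `eternalSteeredRunTwo_of_orders`); §σ2.14‴ K(3) AT p = 2 SUFFICES (`eternalSteeredRunTwo_of_residual_two`,
`eternalSteeredRunTwo_of_orders_two`: the K-obligation of record is the instance `NoEternalIsolatedRadicandChainFinrank 2 3 1`).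
Additive; nothing registered changes (count 6). OURS. -/

/-! ### §σ2.14″ P⁺ ADOPTION LEAVES (stub-3 p505119) and the FinAt-currency T-line. -/

/-- **P⁺ adapter LANDED** (stub-3 p505119 `PBasisDual.finrankDerivationAdapter`, literally `∀ p, FinrankDerivationAdapter p`):
the K-side may work in either currency. OURS. [folklore] -/
theorem finrankDerivationAdapter_holds : ∀ p : ℕ, FinrankDerivationAdapter p :=
  _root_.Summit.ResolutionOfSingularities.ResolutionOfSingularities.Theorems.SwitchingDichotomy.PBasisDual.finrankDerivationAdapter

/-- **P-at LANDED** (stub-3 p505119 `PBasisDual.fgFieldPBasisDualAt`, literally `FGFieldPBasisDualAt`). OURS. [folklore] -/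
theorem fgFieldPBasisDualAt_holds : FGFieldPBasisDualAt :=
  _root_.Summit.ResolutionOfSingularities.ResolutionOfSingularities.Theorems.SwitchingDichotomy.PBasisDual.fgFieldPBasisDualAt

/-- … so a K(3) proof in the DERIVATION currency `…FinAt p 3 1` also closes r23's T-line (adapter inside). Pure logic. OURS. [folklore] -/
theorem eternalSteeredRunTwo_of_residual_finAt (hTail : SteeredTailConclTwo) (hG : GeoDictFinrank)
    (hL : Literature.AlgebraicGeometry.Resolution.Lipman1978NoEternalNormalBranch.{0})
    (hK3 : ∀ p : ℕ, p.Prime → NoEternalIsolatedRadicandChainFinAt p 3 1) : EternalSteeredRunTwo :=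
  eternalSteeredRunTwo_of_residual hTail hG hL fun p hp =>
    noEternalIsolatedRadicandChainFinrank_of_finAt p 3 1 (finrankDerivationAdapter_holds p) (hK3 p hp)

/-! ### §σ2.15 the σ-RESIDUAL RE-CUT BY REGIME at p = 2 (res-L0-w41-strat-2 STRAT2-MEMO-1 §4b 1c50e052ff5379cf, VERBATIM up to a deprecation-free glue proof;
plan-1 adoption 2026-08-27; r24 mini-delta over r23 08fdfe1a18d6e54c). «Cleaned order > p at stage i» (`IsHighOrderAt`) is a REGIME transversal to the three SHAPES of §σ2.10
(PT₁ / ALT₁ / WANDER₁ each have a high-order and a low-order half), so the σ-residual `SteeredTailConclTwo` is ALSO cut into the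
regime PAIR `HighOrderTailConclTwo` (eventually every stage has a p-th-power cleaning in `𝔪ᵢ^(p+1)`) and `LowOrderTailConclTwo`
(cleaned order exactly `p` at infinitely many stages), glued by excluded middle (`steeredTailConclTwo_of_orders`). Both cuts stand:
provers may close the σ-residual through either the 3 shapes or the 2 regimes (or the 2 × 3 grid). OURS. -/

/-- OURS (strat-2): «cleaned order > p at stage i» — some p-th-power cleaning of the radicand `s i ^ p` lies in `𝔪ᵢ^(p+1)`. -/
def IsHighOrderAt (R : ℕ → Subring K) (s : ℕ → K) (p : ℕ) (i : ℕ) : Prop :=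
  ∃ (_ : IsLocalRing (R i)) (hs : s i ^ p ∈ R i) (g : R i),
    (⟨s i ^ p, hs⟩ : R i) - g ^ p ∈ IsLocalRing.maximalIdeal (R i) ^ (p + 1)

/-- **HIGH · HighOrderTailConclTwo** (FRONTIER, σ-residual high-order half; strat-2): p = 2, n = 4, rank one, no dominant tail, and
from some stage on EVERY stage is high-order (`IsHighOrderAt`) ⇒ `Concl`. Structure (strat-2 §3/§4, hand): at point stages cleaned order
≥ 4 triggers the divisor step (B1), order-3 point stages carry the cubic carrier game; positive-dimensional high-order steps are idea-3's
CJS-with-boundary reading. Why it might fail: an eternal non-CI embedding-dimension-4 carrier orbit of cleaned order 3 (strat-2 §4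
cheapest falsifier; K4.1f-σ job). OURS. (ref. CossartJannsenSaito2009, Thm. 5.25) -/
def HighOrderTailConclTwo : Prop :=
  ∀ p : ℕ, p = 2 →
    ∀ (k K : Type) [Field k] [CharP k p] [PerfectField k] [Field K] [Algebra k K]
    (O : ValuationSubring K) (A₀ : Subalgebra k K) (h₀ : A₀.toSubring ≤ O.toSubring) (t : K),
    CoreDatum p 4 k K O A₀ h₀ t → ¬ HasProperCoarsening O →
    ∀ (R : ℕ → Subring K) (P : (i : ℕ) → Ideal (R i)) (s : ℕ → K),
      R 0 = locAtCentre A₀.toSubring O → IsSteeredRun O R P t p s →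
      (¬ ∃ i₀ c : ℕ, 1 ≤ c ∧ IsDominantTail R P i₀ c) →
      (∃ i₀ : ℕ, ∀ i, i₀ ≤ i → IsHighOrderAt R s p i) → Concl O A₀ t

/-- **LOW · LowOrderTailConclTwo** (FRONTIER, σ-residual low-order half; strat-2): p = 2, n = 4, rank one, no dominant tail, and
cleaned order EXACTLY 2 at infinitely many stages ⇒ `Concl`. Structure (strat-2 §4b(3), hand): at an order-2 stage the initial quadric
is `ℓ₁ℓ₂` mod squares (polar rank 4 exits next step, B7), the next centre lies on the line `ℙ(rad b_q)` with `C(c) = 0` (B8), positive-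
dimensional centres lie in the regular surface `V(ℓ₁′, ℓ₂′)` (B9) — a finite-type game (idea-3/tri-3 «hyperbolic splitting» lives here).
Why it might fail: an eternal order-2 run meeting B8's closed condition at every point stage (strat-2 §4b cheapest falsifier, F-ALT deep
families). OURS. (ref. CutkoskyMourtada2019, Thm. 7.1) -/
def LowOrderTailConclTwo : Prop :=
  ∀ p : ℕ, p = 2 →
    ∀ (k K : Type) [Field k] [CharP k p] [PerfectField k] [Field K] [Algebra k K]
    (O : ValuationSubring K) (A₀ : Subalgebra k K) (h₀ : A₀.toSubring ≤ O.toSubring) (t : K),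
    CoreDatum p 4 k K O A₀ h₀ t → ¬ HasProperCoarsening O →
    ∀ (R : ℕ → Subring K) (P : (i : ℕ) → Ideal (R i)) (s : ℕ → K),
      R 0 = locAtCentre A₀.toSubring O → IsSteeredRun O R P t p s →
      (¬ ∃ i₀ c : ℕ, 1 ≤ c ∧ IsDominantTail R P i₀ c) →
      (∀ i₀ : ℕ, ∃ i, i₀ ≤ i ∧ ¬ IsHighOrderAt R s p i) → Concl O A₀ t

/-- The regime re-cut is exhaustive (excluded middle on «eventually always high-order»). Pure logic (strat-2 §4b). OURS. [folklore] -/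
theorem steeredTailConclTwo_of_orders (hH : HighOrderTailConclTwo) (hL : LowOrderTailConclTwo) :
    SteeredTailConclTwo := by
  intro p hp k K _ _ _ _ _ O A₀ h₀ t hcore hrk R P s hR0 hrun hnd
  by_cases h : ∃ i₀ : ℕ, ∀ i, i₀ ≤ i → IsHighOrderAt R s p i
  · exact hH p hp k K O A₀ h₀ t hcore hrk R P s hR0 hrun hnd h
  · refine hL p hp k K O A₀ h₀ t hcore hrk R P s hR0 hrun hnd fun i₀ => ?_
    by_contra hc
    exact h ⟨i₀, fun i hi => by_contra fun hni => hc ⟨i, hi, hni⟩⟩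

/-- **T-LINE through the regime pair** (over r23's `eternalSteeredRunTwo_of_residual`): `EternalSteeredRunTwo` from HIGH, LOW,
G⁺, Lipman 1978 and K(3) (finrank currency). Pure logic. OURS. [folklore] -/
theorem eternalSteeredRunTwo_of_orders (hH : HighOrderTailConclTwo) (hL : LowOrderTailConclTwo) (hG : GeoDictFinrank)
    (hLip : Literature.AlgebraicGeometry.Resolution.Lipman1978NoEternalNormalBranch.{0})
    (hK3 : ∀ p : ℕ, p.Prime → NoEternalIsolatedRadicandChainFinrank p 3 1) : EternalSteeredRunTwo :=
  eternalSteeredRunTwo_of_residual (steeredTailConclTwo_of_orders hH hL) hG hLip hK3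

/-- **K(3) AT p = 2 SUFFICES** (plan-1 RULING on res-D-pv-012 AS stub-8's (o), 2026-08-27): the T-line consumes K(3) only at the
bound prime `p = 2`, so the K-obligation of record for the p = 2 line is the INSTANCE `NoEternalIsolatedRadicandChainFinrank 2 3 1`
(the prime-generic form stays the stronger optional target). Pure logic over r23's pieces. OURS. [folklore] -/
theorem eternalSteeredRunTwo_of_residual_two (hTail : SteeredTailConclTwo) (hG : GeoDictFinrank)
    (hL : Literature.AlgebraicGeometry.Resolution.Lipman1978NoEternalNormalBranch.{0})
    (hK3 : NoEternalIsolatedRadicandChainFinrank 2 3 1) : EternalSteeredRunTwo := by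
  intro p hp2 k K _i1 _i2 _i3 _i4 _i5 O A₀ h₀ t core hrank R P s hR0 hrun
  subst hp2
  have hp : (2 : ℕ).Prime := Nat.prime_two
  by_cases htail : ∃ i₀ c : ℕ, 1 ≤ c ∧ IsDominantTail R P i₀ c
  · obtain ⟨i₀, c, hc1, ht⟩ := htail
    have hnc : ¬ NoEternalIsolatedRadicandChainFinrank 2 c (4 - c) :=
      hG 2 hp 4 le_rfl k K O A₀ h₀ t core R P s i₀ c hR0 hrun ht
    have hc4 : c + 1 ≤ 4 := tailCodimBound_holds 2 hp 4 le_rfl k K O A₀ h₀ t core R P s i₀ c hR0 hrun ht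
    have hc3 : c ≤ 3 := by omega
    interval_cases c
    · exact (hnc (noEternalIsolatedRadicandChainFinrank_of 2 1 (noEternalIsolatedRadicandChain_one_holds 2 hp) 3)).elim
    · exact (hnc (noEternalIsolatedRadicandChainFinrank_of 2 2
        (noEternalIsolatedRadicandChain_two_of_lipman hL 2 hp) 2)).elim
    · exact (hnc hK3).elim
  · exact hTail 2 rfl k K O A₀ h₀ t core hrank R P s hR0 hrun htail

/-- … and through the regime pair. OURS. [folklore] -/
theorem eternalSteeredRunTwo_of_orders_two (hH : HighOrderTailConclTwo) (hLow : LowOrderTailConclTwo) (hG : GeoDictFinrank)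
    (hL : Literature.AlgebraicGeometry.Resolution.Lipman1978NoEternalNormalBranch.{0})
    (hK3 : NoEternalIsolatedRadicandChainFinrank 2 3 1) : EternalSteeredRunTwo :=
  eternalSteeredRunTwo_of_residual_two (steeredTailConclTwo_of_orders hH hLow) hG hL hK3


/-! ### §σ2.17 (holder res-L0-w41-lead-1 g4, r24) — **K(3) IS A PRINTED THEOREM: THE T-LINE ON NAMED-FACT DEBTS** (chain planner
res-L0-w41-plan-1 RULING ×6 07:20:27Z (1), concurring with the holder's FINDING 07:05:06Z). Cossart–Piltant 2019 **Thm. 1.4 (i)**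
(arXiv:1412.0868v1 p. 4) uniformizes `X^p − f` over an excellent regular THREE-dimensional local ring along ANY valuation BY LOCAL
HIRONAKA-PERMISSIBLE BLOWING UPS; by Def. 2.7 (i) (p. 14: `m(y) = m(x)`) the only Hironaka-permissible centre at an ISOLATED singular
point is the closed point, so along an isolated radicand chain Cossart–Piltant's composition IS the chain's point sequence and its regular
member contradicts the cleaned multiplicity `p` — for EVERY `p` and EVERY residue p-rank. NAMED FACT (branch-local special case, weaker
than print): `Literature.AlgebraicGeometry.Resolution.CossartPiltant2019HironakaLUIsolatedBranch` (p508501); bridge (holder, p509311):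
`NoEternalChainThree.noEternalIsolatedRadicandChain_three (hCP) p hp : NoEternalIsolatedRadicandChain p 3`. Hence the K-side of the
e-free line `eternalSteeredRunTwo_of` (§σ2.4) is DISCHARGED MODULO TWO NAMED FACTS (K(1) p500126 ✓ · K(2) ⇐ Lipman 1978 · K(3) ⇐
Cossart–Piltant 2019) with the e-free G `geoDict_holds` (§σ2.14′) and S `tailCodimBound_holds` (§σ2.12): **the ONLY OPEN INPUT of T is
the σ-residual `SteeredTailConclTwo` = HIGH ∧ LOW (§σ2.15)**. The finite-p-rank packages (I)/(II) of §σ2.11/§σ2.13/§σ2.14″ and the G⁺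
slots stay as banked, proved vocabulary of the CP-debt DISCHARGE line (second priority, res-L0-w41-idea-1's K3ᴵ tower). OURS. -/

/-- **K(3) modulo Cossart–Piltant 2019 Thm. 1.4 (i)** (adoption leaf over the holder's p509311). OURS.
[cite: CossartPiltant2019, Thm. 1.4 (i), Def. 2.7, Prop. 2.7] -/
theorem noEternalIsolatedRadicandChain_three_of_CP
    (hCP : Literature.AlgebraicGeometry.Resolution.CossartPiltant2019HironakaLUIsolatedBranch.{0}) :
    ∀ p : ℕ, p.Prime → NoEternalIsolatedRadicandChain p 3 :=
  fun p hp => _root_.Summit.ResolutionOfSingularities.ResolutionOfSingularities.Theorems.SwitchingDichotomy.NoEternalChainThree.noEternalIsolatedRadicandChain_three hCP p hp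

/-- **THE T-LINE OF RECORD (r24): T ⇐ σ-residual + two named facts.** `EternalSteeredRunTwo` from `SteeredTailConclTwo` (FRONTIER),
Lipman 1978 (K(2)) and Cossart–Piltant 2019 Thm. 1.4 (i) (K(3)) — G, S, K(1) by name from the tree. Pure logic. OURS. [folklore] -/
theorem eternalSteeredRunTwo_of_debts (hTail : SteeredTailConclTwo)
    (hL : Literature.AlgebraicGeometry.Resolution.Lipman1978NoEternalNormalBranch.{0})
    (hCP : Literature.AlgebraicGeometry.Resolution.CossartPiltant2019HironakaLUIsolatedBranch.{0}) : EternalSteeredRunTwo :=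
  eternalSteeredRunTwo_of hTail geoDict_holds tailCodimBound_holds noEternalIsolatedRadicandChain_one_holds
    (noEternalIsolatedRadicandChain_two_of_lipman hL) (noEternalIsolatedRadicandChain_three_of_CP hCP)

/-- **… and through res-L0-w41-strat-2's regime cut (§σ2.15): T ⇐ HIGH ∧ LOW + two named facts.** Pure logic. OURS. [folklore] -/
theorem eternalSteeredRunTwo_of_orders_debts (hHigh : HighOrderTailConclTwo) (hLow : LowOrderTailConclTwo)
    (hL : Literature.AlgebraicGeometry.Resolution.Lipman1978NoEternalNormalBranch.{0})
    (hCP : Literature.AlgebraicGeometry.Resolution.CossartPiltant2019HironakaLUIsolatedBranch.{0}) : EternalSteeredRunTwo :=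
  eternalSteeredRunTwo_of_debts (steeredTailConclTwo_of_orders hHigh hLow) hL hCP


end SteeredTwo

end Summit.ResolutionOfSingularities.ResolutionOfSingularities.Theorems.SwitchingDichotomy.Words
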